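import Summits.CriticalPhenomena.Ising3D.Control2DSpectralExponent
import Summits.CriticalPhenomena.Ising3D.Control2DRhoDensityAsymptotics
import Mathlib.Tactic.Linarith
import Mathlib.Tactic.NormNum
import HarnessLib

/-!
# The asymptotic theorems of the typed 2D class as ONE theorem (one import for a referee): E.1u–E.1aa
(cell `pub-ising3x`, seat controls-1 gen 48; PAPER §6.2 / Appendix E.1u–E.1aa — CONTROL-ONLY; the index of gens 45–48 in the shape of
gen 44's `Control2DStructureIndex` / `typedClass_structure` and gen 33's `Control2DRecord` / `control2D_record`)

HONEST FRAMING: lottery ticket; floor = tightest certified 3D Ising CFT bounds; no exact-solution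
claim without a proof. CONTROL-ONLY (`d = 2`, global `sl(2) × sl(2)` blocks, `Δ_σ = s` an INPUT, axiom set
`A2D′`); nothing here is about `d = 3`, no certificate, functional or number of the record is touched, and no
new hypothesis, definition or named fact enters. NO NEW MATHEMATICS: every conjunct below is the theorem of record of its module,
by name, assembled as a term-mode tuple; `#print axioms` of `typedClass_asymptotics` is the referee's one-line check of Appendix
E.1u–E.1aa ({propext, Classical.choice, Quot.sound}).

CONTROL-ONLY FENCE: statements about the control's typed class (`CrossingData.IsUnitary` + `SatisfiesCrossing s` of `Control2DBootstrap`,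
global blocks, `Δ_σ = s` an input) — nothing about any CFT and nothing about `d = 3`. NOT claimed: anything — an index; nothing beyond
the conjuncts' modules; `d = 2`; no number of the record; no new mathematics; in particular none of the items the indexed sections list as
NOT claimed (Korevaar's remainder / PRER's error terms, pointwise lower bounds
in `E`, single-`p_i` bounds beyond E.1x/E.1z, complex `z` / the cut plane, the general `(a, b)` Gauss transformation, `s = 0`, Virasoro, 3D).

THE MAP conjunct ↦ theorem of record ↦ module (proposal id) ↦ App. E section, for
`typedClass_asymptotics (D) (hU) (hC : SatisfiesCrossing s) (hs : 0 < s)` (`P₀ = Σ'_{Δ_i = 0} p_i`):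
 1. `∀ x ∈ (0,1)`, `G(x,x) - 1 = Σ_{(i,m,m')} diagWeight · x^{diagLevel}` ↦ `CrossingData.hasSum_diagStates` ↦ `Control2DDiagonalStates`
    (p672099) ↦ E.1u;
 2. `F(E)/E^{2s} → (1+2P₀)/Γ(2s+1)` ↦ `CrossingData.tendsto_spectralCount_div_rpow` ↦ `Control2DSpectralDensityAsymptotics` (p673586) ↦ E.1u;
 3. `log F(E)/log E → 2s` ↦ `CrossingData.tendsto_log_spectralCount_div_log` ↦ `Control2DSpectralExponent` (p674453) ↦ E.1v;
 4. `∀ x ∈ (0,1), ε > 0`, eventually `Σ'_{E ≤ Δ_i} p_i g_i(x,x) ≤ ((1+2P₀)/Γ(2s+1) + ε)E^{2s}x^E` ↦ `CrossingData.eventually_tail_le_sharp`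
    ↦ `Control2DConvergenceRateSharp` (p681064) ↦ E.1w;
 5. `∀ h ≥ 0, ρ ∈ (0,1)`: `k_{2h}(4ρ/(1+ρ)²) = (4ρ)^h₂F₁(½,h;h+½;ρ²)` ∧ `(4ρ)^h ≤ k_{2h}` ∧ `k_{2h} ≤ (4ρ)^h/√(1-ρ²)` ↦ `chiralBlock_eq_rho`
    (`Control2DRhoExpansion`, p752771, E.1z), `rpow_four_mul_le_chiralBlock` (`Control2DRhoCoordinate`, p746856, E.1x), `chiralBlock_le_rho_sharp`
    (`Control2DRhoEnvelopeSharp`, p753279, E.1z) — pure block facts, independent of `D`;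
 6. `∀ ρ₀ ∈ (0,1), E ≥ 3s, E·log(1/ρ₀) > 4s`: `Σ'_{E ≤ Δ_i} p_i g_i(x₀,x₀) ≤ 2(1-ρ₀²)^{-1}·B·E^{4s}·ρ₀^E·Et/(Et-4s)` at `x₀ = 4ρ₀/(1+ρ₀)²`
    ↦ `CrossingData.tail_le_rho_sharp` ↦ `Control2DRhoEnvelopeSharp` (p753279) ↦ E.1z;
 7. `∀ ρ ∈ (0,1)`, `G(z(ρ),z(ρ)) - 1 = Σ_{(i,n,n')} rhoWeight · ρ^{rhoLevel}` ↦ `CrossingData.hasSum_rhoStates` ↦ `Control2DRhoStates` (p754026)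
    ↦ E.1aa;
 8. `F_ρ(E)/E^{4s} → 16^s(1+2P₀)/Γ(4s+1)` ↦ `CrossingData.tendsto_rhoSpectralCount_div_rpow` ↦ `Control2DRhoDensityAsymptotics` (p754349)
    ↦ E.1aa;
 9. `∀ ρ₀ ∈ (0,1), ε > 0`, eventually `Σ'_{E ≤ Δ_i} p_i g_i(x₀,x₀) ≤ (16^s(1+2P₀)/Γ(4s+1) + ε)E^{4s}ρ₀^E` ↦
    `CrossingData.eventually_rhoTail_le_sharp` ↦ idem (p754349) ↦ E.1aa.
`typedClass_asymptotics_of_pos` (under `∀ i, p_i ≠ 0 → 0 < Δ_i`: any scalar gap, every class of the record): the four Tauberian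
statements with `P₀ = 0` ↦ `tendsto_spectralCount_div_rpow_of_pos` (E.1u), `eventually_tail_le_sharp_of_pos` (E.1w),
`tendsto_rhoSpectralCount_div_rpow_of_pos`, `eventually_rhoTail_le_sharp_of_pos` (E.1aa).
`record_asymptotics (w)` (the record's class at `Δ_σ = 1/8`, CONTROL rows): `record_spectralCount` (E.1u, p673586); `record_log_spectralCount`
(2nd and 3rd components: `log F/log E → 1/4`, uniqueness of `s`; E.1v, p674453); `record_tail_le_sharp` (E.1w, p681064);
`record_sum_p_four_rpow_le` (E.1x, p747218); `record_rhoSpectralCount` (E.1aa, p754349).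

References: D. Pappadopulo, S. Rychkov, J. Espin, R. Rattazzi, Phys. Rev. D 86 (2012) 105043, §4.2–§5.2
[cite: PappadopuloRychkovEspinRattazzi2012PRD, §4.2]; M. Hogervorst, S. Rychkov, Phys. Rev. D 87 (2013) 106004, §2
[cite: HogervorstRychkov2013, §2].
-/

namespace Summit.CriticalPhenomena.Ising3D.Control2D

open Set Filter Topology
open Literature.MathematicalPhysics.QuantumFieldTheory.ConformalBootstrap3D

/-- **The asymptotic theorems of the typed 2D class, one theorem.** For every unitary solution `D` of the typed `⟨σσσσ⟩` sum rule at
`Δ_σ = s > 0` (hypotheses: `IsUnitary`, `SatisfiesCrossing s`, `0 < s` — nothing else), with `P₀ = Σ'_{Δ_i = 0} p_i`: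
(1) the diagonal expansion is the positive series of its states, `G(x,x) - 1 = Σ_{(i,m,m')} 2p_i a_m(h_i)a_{m'}(h̄_i) x^{Δ_i+m+m'}` (E.1u);
(2) the `x`-frame Tauberian equality `F(E)/E^{2s} → (1+2P₀)/Γ(2s+1)` (E.1u); (3) `Δ_σ` is read off the weighted spectrum,
`log F(E)/log E → 2s` (E.1v); (4) the sharp `x`-frame rate: for every `x ∈ (0,1)`, `ε > 0`, eventually
`Σ'_{E ≤ Δ_i} p_i g_i(x,x) ≤ ((1+2P₀)/Γ(2s+1) + ε)E^{2s}x^E` (E.1w); (5) the `ρ`-series of the blocks with its h-free two-sided envelope,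
`k_{2h}(4ρ/(1+ρ)²) = (4ρ)^h₂F₁(½,h;h+½;ρ²)` and `(4ρ)^h ≤ k_{2h} ≤ (4ρ)^h/√(1-ρ²)` for all `h ≥ 0`, `ρ ∈ (0,1)` (E.1x/E.1z; these block
facts are `D`-INDEPENDENT and are carried inside the `D`-quantified statement only so that ONE theorem prints ONE axiom list); (6) the hypothesis-free `ρ`-frame rate `Σ'_{E ≤ Δ_i} p_i g_i(x₀,x₀) ≤ 2(1-ρ₀²)^{-1}·B·E^{4s}·ρ₀^E·Et/(Et-4s)` at
`x₀ = 4ρ₀/(1+ρ₀)²` for `E ≥ 3s`, `Et > 4s`, `t = log(1/ρ₀)` (E.1z); (7) the diagonal expansion is the positive series of its `ρ`-states,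
`G(z(ρ),z(ρ)) - 1 = Σ_{(i,n,n')} 2p_i4^{Δ_i}b_n b_{n'} ρ^{Δ_i+2n+2n'}` (E.1aa); (8) the `ρ`-frame Tauberian equality
`F_ρ(E)/E^{4s} → 16^s(1+2P₀)/Γ(4s+1)` (E.1aa); (9) the rate with the exact prefactor: for every `ρ₀ ∈ (0,1)`, `ε > 0`, eventually
`Σ'_{E ≤ Δ_i} p_i g_i(x₀,x₀) ≤ (16^s(1+2P₀)/Γ(4s+1) + ε)E^{4s}ρ₀^E` (E.1aa). The map conjunct ↦ module ↦ App. E section is in the module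
docstring. CONTROL-ONLY. [cite: PappadopuloRychkovEspinRattazzi2012PRD, §4.2] -/
theorem typedClass_asymptotics (D : CrossingData) (hU : D.IsUnitary) {s : ℝ} (hC : D.SatisfiesCrossing s) (hs : 0 < s) :
    (∀ x : ℝ, x ∈ Ioo (0 : ℝ) 1 →
      HasSum (fun j : D.ι × ℕ × ℕ => D.diagWeight j * x ^ D.diagLevel j) (D.fourPoint x x - 1)) ∧
    Tendsto (fun E : ℝ => D.spectralCount E / E ^ (2 * s)) atTop
      (𝓝 ((1 + 2 * ∑' i : ↥({i : D.ι | D.Δ i = 0} : Set D.ι), D.p i) / Real.Gamma (2 * s + 1))) ∧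
    Tendsto (fun E : ℝ => Real.log (D.spectralCount E) / Real.log E) atTop (𝓝 (2 * s)) ∧
    (∀ x : ℝ, x ∈ Ioo (0 : ℝ) 1 → ∀ ε : ℝ, 0 < ε → ∀ᶠ E : ℝ in atTop,
      ∑' i : ↥({i : D.ι | E ≤ D.Δ i} : Set D.ι), D.p i * globalBlock (D.Δ i) (D.spin i) x x ≤
        ((1 + 2 * ∑' i : ↥({i : D.ι | D.Δ i = 0} : Set D.ι), D.p i) / Real.Gamma (2 * s + 1) + ε) *
          E ^ (2 * s) * x ^ E) ∧
    (∀ h ρ : ℝ, 0 ≤ h → ρ ∈ Ioo (0 : ℝ) 1 →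
      chiralBlock h (4 * ρ / (1 + ρ) ^ 2) = (4 * ρ) ^ h * ordinaryHypergeometric (1 / 2) h (h + 1 / 2) (ρ ^ 2) ∧
      (4 * ρ) ^ h ≤ chiralBlock h (4 * ρ / (1 + ρ) ^ 2) ∧
      chiralBlock h (4 * ρ / (1 + ρ) ^ 2) ≤ (4 * ρ) ^ h / Real.sqrt (1 - ρ ^ 2)) ∧
    (∀ ρ₀ E : ℝ, ρ₀ ∈ Ioo (0 : ℝ) 1 → 3 * s ≤ E → 4 * s < E * Real.log (1 / ρ₀) →
      ∑' i : ↥({i : D.ι | E ≤ D.Δ i} : Set D.ι),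
          D.p i * globalBlock (D.Δ i) (D.spin i) (4 * ρ₀ / (1 + ρ₀) ^ 2) (4 * ρ₀ / (1 + ρ₀) ^ 2) ≤
        2 / (1 - ρ₀ ^ 2) *
          (1 / 2 * Real.exp (4 * s) * (16 : ℝ) ^ s * (5 / (12 * s)) ^ (4 * s) * D.fourPoint (1 / 2) (1 / 2)) *
          E ^ (4 * s) * ρ₀ ^ E * (E * Real.log (1 / ρ₀) / (E * Real.log (1 / ρ₀) - 4 * s))) ∧
    (∀ ρ : ℝ, ρ ∈ Ioo (0 : ℝ) 1 →
      HasSum (fun j : D.ι × ℕ × ℕ => D.rhoWeight j * ρ ^ D.rhoLevel j)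
        (D.fourPoint (4 * ρ / (1 + ρ) ^ 2) (4 * ρ / (1 + ρ) ^ 2) - 1)) ∧
    Tendsto (fun E : ℝ => D.rhoSpectralCount E / E ^ (4 * s)) atTop
      (𝓝 ((16 : ℝ) ^ s * (1 + 2 * ∑' i : ↥({i : D.ι | D.Δ i = 0} : Set D.ι), D.p i) / Real.Gamma (4 * s + 1))) ∧
    (∀ ρ₀ : ℝ, ρ₀ ∈ Ioo (0 : ℝ) 1 → ∀ ε : ℝ, 0 < ε → ∀ᶠ E : ℝ in atTop,
      ∑' i : ↥({i : D.ι | E ≤ D.Δ i} : Set D.ι),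
          D.p i * globalBlock (D.Δ i) (D.spin i) (4 * ρ₀ / (1 + ρ₀) ^ 2) (4 * ρ₀ / (1 + ρ₀) ^ 2) ≤
        ((16 : ℝ) ^ s * (1 + 2 * ∑' i : ↥({i : D.ι | D.Δ i = 0} : Set D.ι), D.p i) / Real.Gamma (4 * s + 1) + ε) *
          E ^ (4 * s) * ρ₀ ^ E) :=
  ⟨fun _ hx => CrossingData.hasSum_diagStates hU (CrossingData.opeConvergent_free hU hC hs) hx,
    CrossingData.tendsto_spectralCount_div_rpow hU hC hs,
    CrossingData.tendsto_log_spectralCount_div_log hU hC hs,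
    fun _ hx _ hε => CrossingData.eventually_tail_le_sharp hU hC hs hx hε,
    fun _ _ hh hρ => ⟨chiralBlock_eq_rho hh hρ, rpow_four_mul_le_chiralBlock hh hρ, chiralBlock_le_rho_sharp hh hρ⟩,
    fun _ _ hρ₀ hE hEt => CrossingData.tail_le_rho_sharp hU hC hs hρ₀ hE hEt,
    fun _ hρ => CrossingData.hasSum_rhoStates hU (CrossingData.opeConvergent_free hU hC hs) hρ,
    CrossingData.tendsto_rhoSpectralCount_div_rpow hU hC hs,
    fun _ hρ₀ _ hε => CrossingData.eventually_rhoTail_le_sharp hU hC hs hρ₀ hε⟩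

/-- **With no weight at dimension zero** (`∀ i, p_i ≠ 0 → 0 < Δ_i`: any scalar gap, every class of the record), the Tauberian
constants are exactly PRER's: `F(E)/E^{2s} → 1/Γ(2s+1)`, eventually `Σ'_{E ≤ Δ_i} p_i g_i(x,x) ≤ (1/Γ(2s+1) + ε)E^{2s}x^E`,
`F_ρ(E)/E^{4s} → 16^s/Γ(4s+1)`, eventually `Σ'_{E ≤ Δ_i} p_i g_i(x₀,x₀) ≤ (16^s/Γ(4s+1) + ε)E^{4s}ρ₀^E` at `x₀ = 4ρ₀/(1+ρ₀)²`.
CONTROL-ONLY. [cite: PappadopuloRychkovEspinRattazzi2012PRD, §4.2] -/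
theorem typedClass_asymptotics_of_pos (D : CrossingData) (hU : D.IsUnitary) {s : ℝ} (hC : D.SatisfiesCrossing s) (hs : 0 < s)
    (hpos : ∀ i, D.p i ≠ 0 → 0 < D.Δ i) :
    Tendsto (fun E : ℝ => D.spectralCount E / E ^ (2 * s)) atTop (𝓝 (1 / Real.Gamma (2 * s + 1))) ∧
    (∀ x : ℝ, x ∈ Ioo (0 : ℝ) 1 → ∀ ε : ℝ, 0 < ε → ∀ᶠ E : ℝ in atTop,
      ∑' i : ↥({i : D.ι | E ≤ D.Δ i} : Set D.ι), D.p i * globalBlock (D.Δ i) (D.spin i) x x ≤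
        (1 / Real.Gamma (2 * s + 1) + ε) * E ^ (2 * s) * x ^ E) ∧
    Tendsto (fun E : ℝ => D.rhoSpectralCount E / E ^ (4 * s)) atTop (𝓝 ((16 : ℝ) ^ s / Real.Gamma (4 * s + 1))) ∧
    (∀ ρ₀ : ℝ, ρ₀ ∈ Ioo (0 : ℝ) 1 → ∀ ε : ℝ, 0 < ε → ∀ᶠ E : ℝ in atTop,
      ∑' i : ↥({i : D.ι | E ≤ D.Δ i} : Set D.ι),
          D.p i * globalBlock (D.Δ i) (D.spin i) (4 * ρ₀ / (1 + ρ₀) ^ 2) (4 * ρ₀ / (1 + ρ₀) ^ 2) ≤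
        ((16 : ℝ) ^ s / Real.Gamma (4 * s + 1) + ε) * E ^ (4 * s) * ρ₀ ^ E) :=
  ⟨CrossingData.tendsto_spectralCount_div_rpow_of_pos hU hC hs hpos,
    fun _ hx _ hε => CrossingData.eventually_tail_le_sharp_of_pos hU hC hs hpos hx hε,
    CrossingData.tendsto_rhoSpectralCount_div_rpow_of_pos hU hC hs hpos,
    fun _ hρ₀ _ hε => CrossingData.eventually_rhoTail_le_sharp_of_pos hU hC hs hpos hρ₀ hε⟩

/-- **The asymptotic CONTROL rows of the record's class at `Δ_σ = 1/8`, one tuple** (binders of E.1n's `record_sum_p_low_le`: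
unitary, typed sum rule at `1/8`, spin 2 in `{2} ∪ [3,∞)`, scalars in `{x} ∪ [2,∞)` with `w ≤ x`; all labels `≥ 0.99` by the record, so
`P₀ = 0`): `F(E)/E^{1/4} → 1/Γ(5/4)` (E.1u); `log F(E)/log E → 1/4` and the datum solves the typed sum rule at no other `s ≥ 0`
(E.1v); eventually `Σ'_{E ≤ Δ_i} p_i g_i(y,y) ≤ (1/Γ(5/4) + ε)E^{1/4}y^E` for every `y ∈ (0,1)` (E.1w); `Σ'_{Δ_i ≤ E} p_i4^{Δ_i} ≤
(7/6)e^{1/2}(4E+1)^{1/2}` for `E ≥ 3/8` (E.1x); `F_ρ(E)/E^{1/2} → 16^{1/8}/Γ(3/2)` and eventually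
`Σ'_{E ≤ Δ_i} p_i g_i(½,½) ≤ (16^{1/8}/Γ(3/2) + ε)E^{1/2}ρ(½)^E` (E.1aa). CONTROL-ONLY; no certificate or number of the record is
touched. [folklore] -/
theorem record_asymptotics (w : ℝ) (D : CrossingData) (hU : D.IsUnitary) (hC : D.SatisfiesCrossing (1 / 8))
    (hT : D.SpinTwoIn ({2} ∪ Ici (2 + 1))) (x : ℝ) (hwx : w ≤ x) (hS : D.ScalarsIn ({x} ∪ Ici 2)) :
    Tendsto (fun E : ℝ => D.spectralCount E / E ^ (1 / 4 : ℝ)) atTop (𝓝 (1 / Real.Gamma (5 / 4))) ∧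
    (Tendsto (fun E : ℝ => Real.log (D.spectralCount E) / Real.log E) atTop (𝓝 (1 / 4)) ∧
      ∀ s : ℝ, 0 ≤ s → D.SatisfiesCrossing s → s = 1 / 8) ∧
    (∀ y : ℝ, y ∈ Ioo (0 : ℝ) 1 → ∀ ε : ℝ, 0 < ε → ∀ᶠ E : ℝ in atTop,
      ∑' i : ↥({i : D.ι | E ≤ D.Δ i} : Set D.ι), D.p i * globalBlock (D.Δ i) (D.spin i) y y ≤
        (1 / Real.Gamma (5 / 4) + ε) * E ^ (1 / 4 : ℝ) * y ^ E) ∧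
    (∀ E : ℝ, 3 / 8 ≤ E → ∑' i : ↥({i : D.ι | D.Δ i ≤ E} : Set D.ι), D.p i * (4 : ℝ) ^ D.Δ (i : D.ι) ≤
      7 / 6 * Real.exp (1 / 2) * (4 * E + 1) ^ (1 / 2 : ℝ)) ∧
    (Tendsto (fun E : ℝ => D.rhoSpectralCount E / E ^ (1 / 2 : ℝ)) atTop
        (𝓝 ((16 : ℝ) ^ (1 / 8 : ℝ) / Real.Gamma (3 / 2))) ∧
      ∀ ε : ℝ, 0 < ε → ∀ᶠ E : ℝ in atTop,
        ∑' i : ↥({i : D.ι | E ≤ D.Δ i} : Set D.ι), D.p i * globalBlock (D.Δ i) (D.spin i) (1 / 2) (1 / 2) ≤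
          ((16 : ℝ) ^ (1 / 8 : ℝ) / Real.Gamma (3 / 2) + ε) * E ^ (1 / 2 : ℝ) *
            ((1 - Real.sqrt (1 - 1 / 2)) / (1 + Real.sqrt (1 - 1 / 2))) ^ E) :=
  ⟨record_spectralCount w D hU hC hT x hwx hS,
    ⟨(record_log_spectralCount w D hU hC hT x hwx hS).2.1, (record_log_spectralCount w D hU hC hT x hwx hS).2.2⟩,
    fun _ hy _ hε => record_tail_le_sharp w D hU hC hT x hwx hS hy hε,
    fun _ hE => record_sum_p_four_rpow_le w D hU hC hT x hwx hS hE,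
    record_rhoSpectralCount w D hU hC hT x hwx hS⟩

end Summit.CriticalPhenomena.Ising3D.Control2D
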